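import Literature.NumberTheory.EllipticCurves.BurungaleSkinner2023.RationalTorsionLineProofs
import Literature.NumberTheory.EllipticCurves.BurungaleSkinner2023.NumPrimesAboveValuesProofs
import Literature.NumberTheory.EllipticCurves.BurungaleSkinner2023.QuadraticCharDiscrProofs
import Literature.NumberTheory.EllipticCurves.Curve11aAnalyticRankZero
import Literature.NumberTheory.EllipticCurves.PAdicBSDSplitMultiplicativeProofs
import Literature.NumberTheory.EllipticCurves.RationalIsogenyFrobeniusCriterion
import Literature.NumberTheory.EllipticCurves.RootNumberProofs
import Literature.NumberTheory.QuadraticFields.ClassNumberOne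
import Literature.NumberTheory.QuadraticFields.KroneckerSplitting
import Literature.NumberTheory.QuadraticFields.RingClassNumberFormula
import Mathlib.Tactic.NormNum.LegendreSymbol
import HarnessLib

/-!
# Burungale–Skinner 2023, Example (E4): the hypotheses of Theorem 2.10 for `X₀(11)` at `p = 5`
# and `ψ = ψ_{ℚ(√-7)}, ψ_{ℚ(√-43)}`, KERNEL-CHECKED (theorems only)

A. Burungale, C. Skinner, Proc. AMS Ser. B 10 (2023), p. 24, Example (E4): "The elliptic curve
11.a2 in the LMFDB list, which has minimal Weierstrass equation `E : y² + y = x³ − x² − 10x − 20`,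
satisfies the hypotheses of Theorem 2.10 for `p = 5`. This curve has a rational `5`-torsion point.
In this case `S = {ℓ₀} = {11}` and `ϕ = 1`. Note that `ℓ₀ ≢ −1 mod 5`. In particular, if `ψ` is an
odd character such that `ψ(11) = +1, ψ(5) = −1, 5 ∤ h_{K_ψ}`, then the conclusions of the theorem
hold for `E^ψ`. In particular, they hold for the `−7` and `−43` twists of `E`."

This file VERIFIES, hypothesis by hypothesis, the typed hypothesis bundle
`Thm210Hypotheses curve11A1 5 Φ 11 K K` (`RankOneTwistsPAdicRegulator.lean`) for the tree's curve
`X1Eleven.curve11A1 = [0,−1,1,−10,−20]` (= LMFDB 11.a2 = Cremona 11A1 = `X₀(11)`), the line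
`Φ = ⟨T̄'⟩ ≤ E[5]` through the rational `5`-torsion point `T' = (5,5)` (`X1ElevenFiveIsogeny.lean`),
`ℓ₀ = 11`, and every imaginary quadratic field `K` of discriminant `−7` or `−43`:

* curve side — `p = 5 ∤ 6N = 66` (tree `conductorNorm_curve11A1 : N = 11`); `11A1` is a global
  minimal model (`isGloballyMinimal_curve11A1`, Silverman VII.1 Rem. 1.1: `p¹² ∤ Δ = −11⁵`); split
  multiplicative reduction at `11` transported from the place-indexed tree theorem
  `hasSplitMultiplicativeReductionAt_curve11A1` (`hasSplitMultiplicativeReductionAtPrime_curve11A1`),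
  good reduction at every `ℓ ≠ 11` (`hasGoodReductionAtPrime_curve11A1`, so (b), (c) are vacuous);
  `r_{11} = 1` (`numPrimesAbove_five_eleven`); `Φ` has order `5` (`addOrderOf T̄' = 5`) and trivial
  `Γ_ℚ`-action (`ϕ = 1`: even, unramified everywhere, order `∣ 2`, `K_{ϕψ} = K_ψ` —
  `RationalTorsionLineProofs.lean`);
* field side, for a quadratic field `K` — the decomposition law (Marcus Ch. 3 Thm. 25; tree
  `ncard_primesOver_eq_two_iff_jacobiSym`, `RingClass.isPrime_span_natCast_of_forall_ne`):
  `(d_K/11) = 1 ⇒ 11` splits (`ψ(11) = +1`, the Heegner hypothesis at `11`),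
  `(d_K/5) = −1 ⇒ (5)` is a prime ideal of `𝓞 K` (`ψ(5) = −1`, tree predicate
  `Zhai2016.IsInertIn K 5`) — `isInertIn_of_legendreSym_eq_neg_one`, a general lemma; Gauss's
  class number one for `d_K ∈ {−3,…,−163}` (tree `isPrincipalIdealRing_of_sq_eq_intCast`) gives
  `5 ∤ h_K = 1`; and `(−7/11) = (−43/11) = 1`, `(−7/5) = (−43/5) = −1` by `norm_num`.

Consequently (`twistConclusion_curve11A1_neg_seven`, `twistConclusion_curve11A1_neg_fortyThree`):
**modulo the single named fact `thm210_twist_rankOne_nondegenerate` (Thm. 2.10 as printed)**,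
`rank E^{(−7)}(ℚ) = ord_{s=1} L(E^{(−7)}, s) = 1`, `λ = 1`, and the `5`-adic height pairing on
(every global minimal model of) `E^{(−7)}`, resp. `E^{(−43)}`, is NON-DEGENERATE — named rank-one, non-CM, residually REDUCIBLE
(`E[5]` reducible), NON-anomalous (`a₅(E^ψ) = ψ(5)·a₅(E) = −1`) instances in which the
non-degeneracy of the `p`-adic height is reduced to one printed theorem with all of its hypotheses
kernel-checked. Theorems only; no new facts.

References: [BurungaleSkinner2023] Example (E4) (p. 24), Thm. 2.10 (p. 23); [CremonaAlgorithms1997]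
Table 1, `N = 11`; [Marcus2018] Ch. 3 Thm. 25; [Cox2013] §5.B Prop. 5.16; [SilvermanAEC2009]
VII.1 Rem. 1.1, VII.5 Prop. 5.1.
-/

noncomputable section

open scoped Classical

open NumberField IsDedekindDomain IsDedekindDomain.HeightOneSpectrum WeierstrassCurve Ideal
  Literature.NumberTheory.EllipticCurves Literature.NumberTheory.EllipticCurves.Rank1Residual
  Literature.NumberTheory.EllipticCurves.X1Eleven Literature.NumberTheory.EllipticCurves.Curve11a
  Literature.NumberTheory.QuadraticFields.Quadratic

namespace Literature.NumberTheory.EllipticCurves.BurungaleSkinner2023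

/-! ### The curve `11A1 = X₀(11)`: minimality, reduction types, the `5`-torsion line -/

section Curve

/-- **`11A1 = [0,−1,1,−10,−20]` is a global minimal model** (`Δ = −11⁵`: no prime has `p¹² ∣ Δ`;
Silverman VII.1 Rem. 1.1 at every prime, tree `isGloballyMinimal_baseChange_int`).
[cite: CremonaAlgorithms1997, Table 1, N = 11, curve A1] -/
theorem isGloballyMinimal_curve11A1 : curve11A1.IsGloballyMinimal := by
  have hΔ : (⟨0, -1, 1, -10, -20⟩ : WeierstrassCurve ℤ).Δ = -11 ^ 5 := by
    norm_num [WeierstrassCurve.Δ, WeierstrassCurve.b₂, WeierstrassCurve.b₄, WeierstrassCurve.b₆,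
      WeierstrassCurve.b₈]
  have h := isGloballyMinimal_baseChange_int (⟨0, -1, 1, -10, -20⟩ : WeierstrassCurve ℤ) (by
    intro p hp
    left
    rw [hΔ]
    intro hd
    have h1 : p ^ 12 ∣ 11 ^ 5 := by exact_mod_cast Int.dvd_neg.mp hd
    have h2 : p ∣ 11 := hp.dvd_of_dvd_pow ((dvd_pow_self p (by norm_num)).trans h1)
    have h3 : p = 11 := (Nat.prime_dvd_prime_iff_eq hp (by norm_num)).mp h2
    subst h3
    have h4 := (Nat.pow_dvd_pow_iff_le_right (by norm_num : 1 < 11)).mp h1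
    omega)
  have e : (⟨0, -1, 1, -10, -20⟩ : WeierstrassCurve ℤ).baseChange ℚ = curve11A1 := by
    ext <;> simp [WeierstrassCurve.baseChange, WeierstrassCurve.map, curve11A1]
  rw [e] at h
  exact h

/-- Transport of `HasSplitMultiplicativeReductionAtPrime` along an equality of primes (the `Fact`
instances are propositionally irrelevant). [folklore] -/
private theorem hasSplitMultiplicativeReductionAtPrime_of_eq {W : WeierstrassCurve ℚ} {p q : ℕ}
    {hp : Fact p.Prime} [Fact q.Prime] (hpq : p = q)
    (h : @WeierstrassCurve.HasSplitMultiplicativeReductionAtPrime W p hp) :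
    W.HasSplitMultiplicativeReductionAtPrime q := by
  subst hpq
  exact h

/-- **`11A1` has split multiplicative reduction at `11`** in the prime-indexed sense
(`HasSplitMultiplicativeReductionAtPrime`, the `ℤ₁₁`-minimal model of `E/ℚ₁₁`): transported from the
place-indexed tree theorem `hasSplitMultiplicativeReductionAt_curve11A1` (`a₁₁ = +1`) along
`hasSplitMultiplicativeReductionAtPrime_iff_hasSplitMultiplicativeReductionAt`. So `11 ∈ S` in the
notation of Thm. 2.10. [cite: CremonaAlgorithms1997, Appendix to Ch. II, Example 1 (N = 11)] -/
theorem hasSplitMultiplicativeReductionAtPrime_curve11A1 [Fact (Nat.Prime 11)] :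
    curve11A1.HasSplitMultiplicativeReductionAtPrime 11 := by
  have h11 : Nat.Prime 11 := by norm_num
  set v := (Rat.HeightOneSpectrum.primesEquiv (R := ℤ)).symm ⟨11, h11⟩ with hv
  have hgen : Rat.HeightOneSpectrum.natGenerator v = 11 :=
    Rat.natGenerator_primesEquiv_symm ⟨11, h11⟩
  have hΔcast : curve11A1.Δ = ((-11 ^ 5 : ℤ) : ℚ) := by rw [curve11A1_Δ]; push_cast; ring
  have hΔ : v.valuation ℚ curve11A1.Δ < 1 := by
    rw [hΔcast, Rat.valuation_intCast_lt_one_iff, hgen]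
    norm_num
  have hsplit := hasSplitMultiplicativeReductionAt_curve11A1 hΔ
  have h := (curve11A1.hasSplitMultiplicativeReductionAtPrime_iff_hasSplitMultiplicativeReductionAt
    v).mpr hsplit
  have hpv : ((Rat.HeightOneSpectrum.primesEquiv v : Nat.Primes) : ℕ) = 11 := by
    rw [hv, Equiv.apply_symm_apply]
  exact hasSplitMultiplicativeReductionAtPrime_of_eq hpv h

/-- `11A1` has multiplicative reduction at `11` (`11 ∉ A`). [cite: CremonaAlgorithms1997, Table 1, N = 11] -/
theorem hasMultiplicativeReductionAtPrime_curve11A1 [Fact (Nat.Prime 11)] :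
    curve11A1.HasMultiplicativeReductionAtPrime 11 :=
  hasSplitMultiplicativeReductionAtPrime_curve11A1.hasMultiplicativeReductionAtPrime

/-- **`11A1` has good reduction at every prime `ℓ ≠ 11`** (`ℓ ∤ Δ = −11⁵`; Silverman VII.5
Prop. 5.1(a) at the place above `ℓ`, tree `hasGoodReductionAt_of_valuation_Δ_eq_one_holds`,
transported by `hasGoodReductionAtPrime_iff_hasGoodReductionAt_holds`).
[cite: SilvermanAEC2009, VII.5 Prop. 5.1(a)] -/
theorem hasGoodReductionAtPrime_curve11A1 {ℓ : ℕ} [hℓ : Fact ℓ.Prime] (h11 : ℓ ≠ 11) :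
    curve11A1.HasGoodReductionAtPrime ℓ := by
  set v := (Rat.HeightOneSpectrum.primesEquiv (R := ℤ)).symm ⟨ℓ, hℓ.out⟩ with hv
  have hgen : Rat.HeightOneSpectrum.natGenerator v = ℓ := Rat.natGenerator_primesEquiv_symm ⟨ℓ, hℓ.out⟩
  have hΔcast : curve11A1.Δ = ((-11 ^ 5 : ℤ) : ℚ) := by rw [curve11A1_Δ]; push_cast; ring
  have hΔ : v.valuation ℚ curve11A1.Δ = 1 := by
    rw [hΔcast, Rat.valuation_intCast_eq_one_iff, hgen]
    intro hd
    have hd' : ℓ ∣ 11 ^ 5 := by exact_mod_cast Int.dvd_neg.mp hd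
    exact h11 ((Nat.prime_dvd_prime_iff_eq hℓ.out (by norm_num)).mp (hℓ.out.dvd_of_dvd_pow hd'))
  have hgood := hasGoodReductionAt_of_valuation_Δ_eq_one_holds v curve11A1 (curve11A1_isIntegralAt v) hΔ
  exact (curve11A1.hasGoodReductionAtPrime_iff_hasGoodReductionAt_holds ⟨ℓ, hℓ.out⟩).mpr hgood

/-- `11A1` does not have multiplicative reduction at any prime `ℓ ≠ 11` (good there; Mathlib
`HasGoodReduction.not_hasMultiplicativeReduction`). [cite: SilvermanAEC2009, VII.5 Prop. 5.1] -/
theorem not_hasMultiplicativeReductionAtPrime_curve11A1 {ℓ : ℕ} [Fact ℓ.Prime] (h11 : ℓ ≠ 11) :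
    ¬ curve11A1.HasMultiplicativeReductionAtPrime ℓ :=
  (hasGoodReductionAtPrime_curve11A1 h11).not_hasMultiplicativeReduction

/-- `T̄' ∈ E[5]` for `E = 11A1`. [cite: CremonaAlgorithms1997, Table 1, N = 11, curve A1 (|T| = 5)] -/
theorem T'bar_mem_geomTorsion : T'bar ∈ geomTorsion curve11A1 ((5 : ℕ) : ℤ) := by
  rw [mem_torsionBy_iff, natCast_zsmul]
  exact five_nsmul_T'bar

/-- `T̄'` has order exactly `5`. [cite: CremonaAlgorithms1997, Table 1, N = 11, curve A1 (|T| = 5)] -/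
theorem addOrderOf_T'bar [Fact (Nat.Prime 5)] : addOrderOf T'bar = 5 :=
  addOrderOf_eq_prime five_nsmul_T'bar T'bar_ne_zero

/-- **The rational `5`-torsion line `Φ = ⟨T̄'⟩ ≤ E[5]` of `11A1`**: it has `5` elements, `Γ_ℚ`
acts trivially on it (`ϕ = 1`), hence it is a rational line. [cite: BurungaleSkinner2023, Example (E4) (p. 24)] -/
theorem line_curve11A1 [Fact (Nat.Prime 5)] :
    ∃ Φ : AddSubgroup (geomTorsion curve11A1 ((5 : ℕ) : ℤ)),
      Nat.card Φ = 5 ∧ ∀ (σ : Field.absoluteGaloisGroup ℚ), ∀ P ∈ Φ, σ • P = P := by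
  set Tt : geomTorsion curve11A1 ((5 : ℕ) : ℤ) := ⟨T'bar, T'bar_mem_geomTorsion⟩ with hTt
  have hfix : ∀ σ : Field.absoluteGaloisGroup ℚ, σ • Tt = Tt := fun σ =>
    Subtype.ext (smul_T'bar σ)
  have hord : addOrderOf Tt = 5 := by
    rw [← AddSubgroup.addOrderOf_coe]
    exact addOrderOf_T'bar
  refine ⟨AddSubgroup.zmultiples Tt, ?_, ?_⟩
  · rw [Nat.card_zmultiples, hord]
  · intro σ P hP
    obtain ⟨k, rfl⟩ := AddSubgroup.mem_zmultiples_iff.mp hP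
    rw [smul_comm σ k Tt, hfix]

end Curve

/-! ### Quadratic fields: the decomposition law as used in (E4) -/

section Field

variable {K : Type*} [Field K] [NumberField K]

/-- **Inert case of the decomposition law, ideal-theoretically: `(d_K/p) = −1 ⇒ p𝓞_K` is a prime
ideal** (`p` odd; tree predicate `Zhai2016.IsInertIn K p`). With an integral basis `(1, ω)`,
`ω² = m + tω`, `d_K = t² + 4m`; a root `c` of `X² − tX − m` mod `p` would make
`(2c − t)² = d_K` a square mod `p`; so there is none and `p𝓞_K` is prime (tree
`RingClass.isPrime_span_natCast_of_forall_ne`). [cite: Marcus2018, Ch. 3 Thm. 25 (decomposition law, inert case)] -/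
theorem isInertIn_of_legendreSym_eq_neg_one {K : Type} [Field K] [NumberField K]
    (h2 : Module.finrank ℚ K = 2) {p : ℕ} [Fact p.Prime]
    (hl : legendreSym p (NumberField.discr K) = -1) : Zhai2016.IsInertIn K p := by
  obtain ⟨b, hb⟩ := exists_basis_zero_eq_one h2
  have hω := basis_one_mul_self_eq b hb
  have hdisc := discr_eq_sq_add_four_mul b hb
  unfold Zhai2016.IsInertIn
  rw [Int.cast_natCast]
  refine Literature.NumberTheory.QuadraticFields.RingClass.isPrime_span_natCast_of_forall_ne b hb hω
    fun c hc => ?_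
  have hsq : IsSquare ((NumberField.discr K : ℤ) : ZMod p) := by
    refine ⟨2 * c - ((b.repr (b 1 * b 1) 1 : ℤ) : ZMod p), ?_⟩
    rw [hdisc]
    push_cast
    linear_combination (-4 : ZMod p) * hc
  exact (legendreSym.eq_neg_one_iff p).mp hl hsq

/-- **Split case at a prime level: `(d_K/q) = 1 ⇒` the Heegner hypothesis for `N = q`** (`q` odd
prime: both primes of `𝓞_K` above `q`, tree `ncard_primesOver_eq_two_iff_jacobiSym`).
[cite: Marcus2018, Ch. 3 Thm. 25 (decomposition law, split case)] -/
theorem satisfiesHeegnerHypothesis_prime_of_jacobiSym_eq_one {K : Type} [Field K] [NumberField K]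
    (h2 : Module.finrank ℚ K = 2) {q : ℕ} (hq : q.Prime) (hq2 : q ≠ 2)
    (hj : jacobiSym (NumberField.discr K) q = 1) : SatisfiesHeegnerHypothesis q K := by
  intro p hp hpq
  have hpq' : p = q := (Nat.prime_dvd_prime_iff_eq hp hq).mp hpq
  subst hpq'
  exact (ncard_primesOver_eq_two_iff_jacobiSym h2 hp hq2).mpr hj

/-- **Gauss's nine fields: `h_K = 1` for `d_K ∈ {−3,−4,−7,−8,−11,−19,−43,−67,−163}`** (tree
`isPrincipalIdealRing_of_sq_eq_intCast` applied to `√d_K ∈ 𝓞_K`, tree `exists_sq_eq_discr`;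
Mathlib `classNumber_eq_one_iff`). [cite: Marcus2018, Ch. 5 (after Cor. 2 of Thm. 37)] -/
theorem classNumber_eq_one_of_discr_mem {K : Type} [Field K] [NumberField K]
    (h2 : Module.finrank ℚ K = 2)
    (hd : NumberField.discr K ∈ ({-3, -4, -7, -8, -11, -19, -43, -67, -163} : Finset ℤ)) :
    NumberField.classNumber K = 1 := by
  obtain ⟨-, -, δ, -, hδ⟩ := exists_sq_eq_discr h2
  have hθ : ((δ : 𝓞 K) : K) ^ 2 = ((NumberField.discr K : ℤ) : K) := by
    have := congrArg ((↑) : 𝓞 K → K) hδ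
    push_cast at this
    exact this
  exact NumberField.classNumber_eq_one_iff.mpr (isPrincipalIdealRing_of_sq_eq_intCast h2 hθ hd)

end Field

/-! ### Example (E4): the hypotheses of Thm. 2.10 for `X₀(11)`, `p = 5`, `ℓ₀ = 11`, `ψ = ψ_K` -/

section E4

/-- **(E4), generic in the odd character `ψ = ψ_K`.** For `E = X₀(11) = 11A1`, `p = 5`, `ℓ₀ = 11`,
`Φ = ⟨T̄'⟩` and an imaginary quadratic field `K` with `(d_K/11) = 1` ("`ψ(11) = +1`"),
`(d_K/5) = −1` ("`ψ(5) = −1`", so also `5 ∤ d_K`) and `5 ∤ h_K` ("`5 ∤ h_{K_ψ}`"; `K_{ϕψ} = K_ψ` as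
`ϕ = 1`), ALL the hypotheses `Thm210Hypotheses E 5 Φ 11 K K` of Thm. 2.10 hold.
[cite: BurungaleSkinner2023, Example (E4) (p. 24)] -/
theorem thm210Hypotheses_curve11A1 [Fact (Nat.Prime 5)] [Fact (Nat.Prime 11)]
    (K : Type) [Field K] [NumberField K] (hK : IsImaginaryQuadratic K)
    (h11 : jacobiSym (NumberField.discr K) 11 = 1) (h5 : legendreSym 5 (NumberField.discr K) = -1)
    (h5d : ¬ (5 : ℤ) ∣ NumberField.discr K) (hh : ¬ 5 ∣ NumberField.classNumber K) :
    haveI := isGloballyMinimal_curve11A1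
    ∃ Φ : AddSubgroup (geomTorsion curve11A1 ((5 : ℕ) : ℤ)), Thm210Hypotheses curve11A1 5 Φ 11 K K := by
  haveI := isGloballyMinimal_curve11A1
  obtain ⟨Φ, hcard, htriv⟩ := line_curve11A1
  refine ⟨Φ, ?_⟩
  exact {
    not_dvd_six_mul_conductor := by rw [conductorNorm_curve11A1]; decide
    isRationalLine := ⟨hcard, fun σ P hP => by rw [htriv σ P hP]; exact hP⟩
    lineOrderDvdTwo := lineOrderDvdTwo_of_forall_smul_eq htriv
    lineEven := lineEven_of_forall_smul_eq htriv
    lineUnramifiedAt := lineUnramifiedAt_of_forall_smul_eq htriv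
    ell0_dvd_conductor := by rw [conductorNorm_curve11A1]
    mult_ell0 := hasMultiplicativeReductionAtPrime_curve11A1
    numPrimesAbove_ell0 := numPrimesAbove_five_eleven
    isImaginaryQuadratic := hK
    isImaginaryQuadratic' := hK
    isProductCharacterField := isProductCharacterField_self_of_isImaginaryQuadratic htriv K hK
    not_dvd_discr := h5d
    lineUnramifiedAt_of_dvd_discr := fun ℓ _ _ => lineUnramifiedAtPrime_of_forall_smul_eq htriv ℓ
    a_split := fun _ =>
      satisfiesHeegnerHypothesis_prime_of_jacobiSym_eq_one hK.1 (by norm_num) (by norm_num) h11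
    a_nonsplit := fun h => absurd hasSplitMultiplicativeReductionAtPrime_curve11A1 h
    b := by
      intro ℓ _ hne hs
      exact absurd hs.hasMultiplicativeReductionAtPrime
        (not_hasMultiplicativeReductionAtPrime_curve11A1 hne)
    c := by
      intro ℓ _ hne hm _
      exact absurd hm (not_hasMultiplicativeReductionAtPrime_curve11A1 hne)
    d := isInertIn_of_legendreSym_eq_neg_one hK.1 h5
    e := hh }

/-- **(E4) for `ψ = ψ_{ℚ(√−7)}`**: `(−7/11) = 1`, `(−7/5) = −1`, `h(−7) = 1`.
[cite: BurungaleSkinner2023, Example (E4) (p. 24)] -/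
theorem thm210Hypotheses_curve11A1_of_discr_eq_neg_seven [Fact (Nat.Prime 5)] [Fact (Nat.Prime 11)]
    (K : Type) [Field K] [NumberField K] (hK : IsImaginaryQuadratic K)
    (hd : NumberField.discr K = -7) :
    haveI := isGloballyMinimal_curve11A1
    ∃ Φ : AddSubgroup (geomTorsion curve11A1 ((5 : ℕ) : ℤ)), Thm210Hypotheses curve11A1 5 Φ 11 K K :=
  thm210Hypotheses_curve11A1 K hK (by rw [hd]; norm_num) (by rw [hd]; norm_num) (by rw [hd]; decide)
    (by rw [classNumber_eq_one_of_discr_mem hK.1 (by rw [hd]; decide)]; decide)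

/-- **(E4) for `ψ = ψ_{ℚ(√−43)}`**: `(−43/11) = 1`, `(−43/5) = −1`, `h(−43) = 1`.
[cite: BurungaleSkinner2023, Example (E4) (p. 24)] -/
theorem thm210Hypotheses_curve11A1_of_discr_eq_neg_fortyThree [Fact (Nat.Prime 5)]
    [Fact (Nat.Prime 11)] (K : Type) [Field K] [NumberField K] (hK : IsImaginaryQuadratic K)
    (hd : NumberField.discr K = -43) :
    haveI := isGloballyMinimal_curve11A1
    ∃ Φ : AddSubgroup (geomTorsion curve11A1 ((5 : ℕ) : ℤ)), Thm210Hypotheses curve11A1 5 Φ 11 K K :=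
  thm210Hypotheses_curve11A1 K hK (by rw [hd]; norm_num) (by rw [hd]; norm_num) (by rw [hd]; decide)
    (by rw [classNumber_eq_one_of_discr_mem hK.1 (by rw [hd]; decide)]; decide)

/-- **(E4) as printed, modulo Thm. 2.10 by name:** "if `ψ` is an odd character such that
`ψ(11) = +1, ψ(5) = −1, 5 ∤ h_{K_ψ}`, then the conclusions of the theorem hold for `E^ψ`" — for every
imaginary quadratic `K` with `(d_K/11) = 1`, `(d_K/5) = −1`, `5 ∤ h_K`, granting
`thm210_twist_rankOne_nondegenerate`: `TwistConclusion X₀(11) 5 d_K` (rank `= ord_{s=1} L = 1`,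
`λ = 1`, non-degenerate `5`-adic height on every global minimal model of `E^{(d_K)}`). (`5 ∤ d_K` is
implied by `(d_K/5) = −1`.) [cite: BurungaleSkinner2023, Example (E4) (p. 24)] -/
theorem twistConclusion_curve11A1_of_jacobiSym [Fact (Nat.Prime 5)] [Fact (Nat.Prime 11)]
    (h : thm210_twist_rankOne_nondegenerate) (K : Type) [Field K] [NumberField K]
    (hK : IsImaginaryQuadratic K) (h11 : jacobiSym (NumberField.discr K) 11 = 1)
    (h5 : legendreSym 5 (NumberField.discr K) = -1) (hh : ¬ 5 ∣ NumberField.classNumber K) :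
    haveI := isGloballyMinimal_curve11A1
    TwistConclusion curve11A1 5 (NumberField.discr K) := by
  haveI := isGloballyMinimal_curve11A1
  have h5d : ¬ (5 : ℤ) ∣ NumberField.discr K := by
    intro hd
    have h0 : legendreSym 5 (NumberField.discr K) = 0 :=
      (legendreSym.eq_zero_iff 5 _).mpr ((ZMod.intCast_zmod_eq_zero_iff_dvd _ 5).mpr hd)
    rw [h0] at h5
    exact absurd h5 (by decide)
  obtain ⟨Φ, hΦ⟩ := thm210Hypotheses_curve11A1 K hK h11 h5 h5d hh
  exact h curve11A1 5 Φ 11 K K hΦ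

/-- `−7 = d_{ℚ(√−7)}` is the discriminant of an imaginary quadratic field. [cite: Cox2013, §5.B] -/
theorem isOddQuadraticCharDiscr_neg_seven : IsOddQuadraticCharDiscr (-7) := by
  refine isOddQuadraticCharDiscr_iff.mpr ⟨Or.inl ⟨by decide, ?_, by decide⟩, by norm_num⟩
  rw [← Int.squarefree_natAbs]
  exact (show Nat.Prime 7 by norm_num).prime.squarefree

/-- `−43 = d_{ℚ(√−43)}` is the discriminant of an imaginary quadratic field. [cite: Cox2013, §5.B] -/
theorem isOddQuadraticCharDiscr_neg_fortyThree : IsOddQuadraticCharDiscr (-43) := by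
  refine isOddQuadraticCharDiscr_iff.mpr ⟨Or.inl ⟨by decide, ?_, by decide⟩, by norm_num⟩
  rw [← Int.squarefree_natAbs]
  exact (show Nat.Prime 43 by norm_num).prime.squarefree

/-- **The `−7` twist of `X₀(11)`, modulo Thm. 2.10 by name.** Granting the named fact
`thm210_twist_rankOne_nondegenerate` (Burungale–Skinner Thm. 2.10 as printed), all of whose
hypotheses for `(X₀(11), 5, ψ_{ℚ(√−7)})` are kernel-checked above:
`rank E^{(−7)}(ℚ) = ord_{s=1} L(E^{(−7)}, s) = 1`, `λ(L_{E^{(−7)}}) = 1`, and the `5`-adic height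
pairing on every global minimal model of `E^{(−7)}` is non-degenerate (`TwistConclusion`).
"In particular, they hold for the `−7` and `−43` twists of `E`." [cite: BurungaleSkinner2023, Example (E4) (p. 24)] -/
theorem twistConclusion_curve11A1_neg_seven [Fact (Nat.Prime 5)] [Fact (Nat.Prime 11)]
    (h : thm210_twist_rankOne_nondegenerate) :
    haveI := isGloballyMinimal_curve11A1
    TwistConclusion curve11A1 5 (-7) := by
  haveI := isGloballyMinimal_curve11A1
  obtain ⟨K, _, _, hK, hd⟩ := isOddQuadraticCharDiscr_neg_seven
  obtain ⟨Φ, hΦ⟩ := thm210Hypotheses_curve11A1_of_discr_eq_neg_seven K hK hd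
  have hc := h curve11A1 5 Φ 11 K K hΦ
  rwa [hd] at hc

/-- **The `−43` twist of `X₀(11)`, modulo Thm. 2.10 by name** (as for `−7`).
[cite: BurungaleSkinner2023, Example (E4) (p. 24)] -/
theorem twistConclusion_curve11A1_neg_fortyThree [Fact (Nat.Prime 5)] [Fact (Nat.Prime 11)]
    (h : thm210_twist_rankOne_nondegenerate) :
    haveI := isGloballyMinimal_curve11A1
    TwistConclusion curve11A1 5 (-43) := by
  haveI := isGloballyMinimal_curve11A1
  obtain ⟨K, _, _, hK, hd⟩ := isOddQuadraticCharDiscr_neg_fortyThree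
  obtain ⟨Φ, hΦ⟩ := thm210Hypotheses_curve11A1_of_discr_eq_neg_fortyThree K hK hd
  have hc := h curve11A1 5 Φ 11 K K hΦ
  rwa [hd] at hc

/-- **Read-outs for the `−7` twist**: the `5`-adic regulator of every global minimal model of
`E^{(−7)}`, `E = X₀(11)`, is non-zero, and `rank = ord_{s=1} L = 1` — modulo Thm. 2.10 by name.
[cite: BurungaleSkinner2023, Example (E4) (p. 24)] -/
theorem padicHeightNondegenerate_twist_curve11A1_neg_seven [Fact (Nat.Prime 5)] [Fact (Nat.Prime 11)]
    (h : thm210_twist_rankOne_nondegenerate) (W' : WeierstrassCurve ℚ) [W'.IsElliptic]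
    [W'.IsGloballyMinimal] (C : VariableChange ℚ)
    (hC : C • curve11A1.quadraticTwist ((-7 : ℤ) : ℚ) = W') :
    PAdicHeightNondegenerate W' 5 ∧ (curve11A1.quadraticTwist ((-7 : ℤ) : ℚ)).mordellWeilRank = 1 ∧
      (curve11A1.quadraticTwist ((-7 : ℤ) : ℚ)).analyticRank = 1 := by
  have hc := twistConclusion_curve11A1_neg_seven h
  exact ⟨(hc.2.2 W' C hC).2, hc.1, hc.2.1⟩

/-- **The `5`-part of the BSD formula for the `−7` twist of `X₀(11)`, modulo Thm. 3.1 by name**: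
granting `thm31_twist_pPartBSD_rankOne`, `ord_{s=1} L(E^{(−7)}, s) = 1` and the printed `5`-part
identity `|L'(E^ψ,1)/(Ω Reg)|_5^{-1} = |#Ш · Tam|_5^{-1}` (`PPartRankOnePrintShape W' 5`) holds for
every global minimal model `W'` of `E^{(−7)}`. [cite: BurungaleSkinner2023, Thm. 3.1 (p. 25) with Example (E4) (p. 24)] -/
theorem pPartBSD_twist_curve11A1_neg_seven [Fact (Nat.Prime 5)] [Fact (Nat.Prime 11)]
    (h : thm31_twist_pPartBSD_rankOne) :
    (curve11A1.quadraticTwist ((-7 : ℤ) : ℚ)).analyticRank = 1 ∧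
      ∀ (W' : WeierstrassCurve ℚ) [W'.IsElliptic] [W'.IsGloballyMinimal] (C : VariableChange ℚ),
        C • curve11A1.quadraticTwist ((-7 : ℤ) : ℚ) = W' → PPartRankOnePrintShape W' 5 := by
  haveI := isGloballyMinimal_curve11A1
  obtain ⟨K, _, _, hK, hd⟩ := isOddQuadraticCharDiscr_neg_seven
  obtain ⟨Φ, hΦ⟩ := thm210Hypotheses_curve11A1_of_discr_eq_neg_seven K hK hd
  have hc := h curve11A1 5 11 K K (Or.inr ⟨Φ, hΦ⟩)
  rwa [hd] at hc

end E4

end Literature.NumberTheory.EllipticCurves.BurungaleSkinner2023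

end
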